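import Literature.Computability.QuantumComplexity.GRPredicates
import Literature.Computability.QuantumComplexity.GaussianCells
import HarnessLib

/-!
# The cosine word of the Grover–Rudolph level machine: fixed-width words and prefix values

Topic `Literature/Computability/QuantumComplexity`; the arithmetic specification of the classical
cosine machine of the Grover–Rudolph block (`GRData.Mach.spec`, `GRLevelConj.MachOK.len`) in Regev's
sampler (Lemma 3.12, proof; §2 p. 11 finite precision). The machine reads the prefix bits
`y₀ … y_{j−1}` (most significant first, the convention of `GaussianCells.hiVal`) and writes the
`(k+1)`-bit least-significant-first word of `F = 2^k − A`, `A ≤ 2^k` the integer cosine numerator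
(`GaussianCellsAngles.machineA`); then the encoded cosine of `GRPredicates.aTil` is EXACTLY `A/2^k`:

* `bitsLE w m` (the `w` low bits of `m`, least significant first; `length_bitsLE`, `bitsToNat_bitsLE`);
* `cosWord k A = bitsLE (k+1) (2^k − A)` with `length_cosWord`, `bitsToNat_cosWord` and
  **`aTil_cosWord`**: `aTil (k+1) (bitsToNat (cosWord k A)) = A / 2^k`;
* **`hiVal_eq_bitsToNat_reverse`**: `hiVal j y = bitsToNat (reverse [y₀, …, y_{j−1}])`.

Everything here is proved; definitions have bodies; no named fact is introduced.

## References

* O. Regev, J. ACM 56 (2009), art. 34, Lemma 3.12 (proof) and §2, p. 11 [Regev2009].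
* D. E. Knuth, *The Art of Computer Programming*, Vol. 2, 3rd ed., 1998, §4.1 (positional number systems) [KnuthTAOCP2].
-/

namespace Literature.Computability.QuantumComplexity

open Literature.Computability.Complexity (bitsToNat bitsToNat_cons)
open Literature.Computability.Complexity.Com (testBit_bitsToNat)
open Finset GaussianCells

/-! ### Fixed-width least-significant-first words -/

/-- **The `w` low bits of `m`**, least significant first. [cite: KnuthTAOCP2, §4.1] -/
def bitsLE (w m : ℕ) : List Bool := List.ofFn fun i : Fin w => m.testBit i

/-- The word has length `w`. [folklore] -/
@[simp] theorem length_bitsLE (w m : ℕ) : (bitsLE w m).length = w := List.length_ofFn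

/-- **The value of the word is `m`** for `m < 2^w`. [cite: KnuthTAOCP2, §4.1] -/
theorem bitsToNat_bitsLE {w m : ℕ} (hm : m < 2 ^ w) : bitsToNat (bitsLE w m) = m := by
  refine Nat.eq_of_testBit_eq fun i => ?_
  rw [testBit_bitsToNat, bitsLE, List.getD_eq_getElem?_getD, List.getElem?_ofFn]
  by_cases hi : i < w
  · simp [hi]
  · simp only [hi, dite_false, Option.getD_none]
    exact (Nat.testBit_lt_two_pow (lt_of_lt_of_le hm (Nat.pow_le_pow_right (by norm_num) (Nat.not_lt.1 hi)))).symm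

/-! ### The cosine word -/

/-- **The cosine word**: the `(k+1)`-bit word of `2^k − A`. [cite: Regev2009, Lemma 3.12 (proof) with §2 p. 11] -/
def cosWord (k A : ℕ) : List Bool := bitsLE (k + 1) (2 ^ k - A)

/-- The cosine word has length `k + 1`. [folklore] -/
@[simp] theorem length_cosWord (k A : ℕ) : (cosWord k A).length = k + 1 := length_bitsLE _ _

/-- The value of the cosine word. [folklore] -/
theorem bitsToNat_cosWord (k A : ℕ) : bitsToNat (cosWord k A) = 2 ^ k - A :=
  bitsToNat_bitsLE (lt_of_le_of_lt (Nat.sub_le _ _) (Nat.pow_lt_pow_right (by norm_num) (Nat.lt_succ_self k)))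

/-- **The encoded cosine of the cosine word is exactly `A/2^k`** (`A ≤ 2^k`). [cite: Regev2009, Lemma 3.12 (proof)] -/
theorem aTil_cosWord {k A : ℕ} (hA : A ≤ 2 ^ k) : SLP.aTil (k + 1) (bitsToNat (cosWord k A)) = (A : ℝ) / 2 ^ k := by
  rw [bitsToNat_cosWord, SLP.aTil, Nat.cast_sub hA, pow_succ]
  push_cast
  field_simp
  ring

/-! ### Prefix values -/

/-- **The prefix value is the value of the reversed prefix word**:
`hiVal j y = bitsToNat (reverse [y₀, …, y_{j−1}])` (`j ≤ ℓ`). [cite: KnuthTAOCP2, §4.1 (Horner)] -/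
theorem hiVal_eq_bitsToNat_reverse {ℓ : ℕ} (y : Fin ℓ → Bool) :
    ∀ (j : ℕ) (hj : j ≤ ℓ), hiVal j y = bitsToNat (List.ofFn fun i : Fin j => y ⟨i, lt_of_lt_of_le i.2 hj⟩).reverse
  | 0, _ => by simp
  | j + 1, hj => by
    have hj' : j < ℓ := hj
    have h := hiVal_succ ⟨j, hj'⟩ y
    rw [h, hiVal_eq_bitsToNat_reverse y j hj'.le, List.ofFn_succ', List.concat_eq_append, List.reverse_append, List.reverse_singleton,
      List.singleton_append, bitsToNat_cons]
    simp only [Fin.val_castSucc, Fin.val_last]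
    cases y ⟨j, hj'⟩ <;> simp; ring

end Literature.Computability.QuantumComplexity
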